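import Summits.ResolutionOfSingularities.ResolutionOfSingularities.Theorems.ValuativeLuAlphaPTorsorDimTwoDefectless
import Summits.ResolutionOfSingularities.ResolutionOfSingularities.Theorems.ValuativeLuAlphaPTorsorCurveMonomialization

/-!
# `LuAlphaPTorsor` in base dimension two outside the defect case — unconditional

Crux `Valuative.LuAlphaPTorsor` (item `stmt-ResolutionOfSingularities-0641`), line
`pfaff-line-log-final-forms`. The headline corollary of the line's gen-2 skeleton with all its
dimension-two worker stubs LANDED: `luAlphaPTorsor_dimTwo_of_not_immediate_of_curveMono`
(`…DimTwoDefectless.lean`) discharged of its first hypothesis by `stub_curveMonomialization`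
(`…CurveMonomialization.lean`, monomialization of one element along the quadratic sequence of a
two-dimensional regular local ring):

* `luAlphaPTorsor_dimTwo_of_not_immediate` — for EVERY ground field `k` of characteristic `p`,
  every valuation ring `O` of `K ⊇ k`, every finitely generated `A₀ ⊆ O` regular of dimension
  TWO at the centre and `t` with `t^p ∈ A₀`, `Frac (A₀[t]) = K`: if `t` has a best approximation
  in `K₀ = Frac A₀` (i.e. `K/K₀` is not immediate at `ν` — automatic when it is defectless,
  `…BestApproximation.lean`), then some finitely generated `A ⊇ A₀[t]` inside `O` with
  `Frac A = K` is regular at the centre.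

So in base dimension two the crux `LuAlphaPTorsor` is reduced to the IMMEDIATE (defect) case.
-/

set_option linter.dupNamespace false

namespace Summit.ResolutionOfSingularities.ResolutionOfSingularities.Theorems.PfaffLine

/-- **`LuAlphaPTorsor` in base dimension two for torsor extensions that are not immediate at
`ν`** (unconditional; `luAlphaPTorsor_dimTwo_of_not_immediate_of_curveMono` with its first
hypothesis discharged by `stub_curveMonomialization`). [folklore assembly; Abhyankar 1956 /
Zariski for the birational geometry of the two-dimensional base] -/
theorem luAlphaPTorsor_dimTwo_of_not_immediate :
    ∀ p : ℕ, p.Prime → ∀ (k K : Type) [Field k] [CharP k p] [Field K] [Algebra k K] (O : ValuationSubring K) (A₀ : Subalgebra k K) (h₀ : A₀.toSubring ≤ O.toSubring) (t : K), A₀.FG → t ^ p ∈ A₀ → IsFractionRing (Algebra.adjoin k (insert t (A₀ : Set K))) K → IsRegularLocalRing (Localization.AtPrime (Ideal.comap (Subring.inclusion h₀) (IsLocalRing.maximalIdeal O))) → ringKrullDim (Localization.AtPrime (Ideal.comap (Subring.inclusion h₀) (IsLocalRing.maximalIdeal O))) = 2 → (∃ c : K, c ∈ Subfield.closure (A₀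 : Set K) ∧ ∀ c' : K, c' ∈ Subfield.closure (A₀ : Set K) → O.valuation (t - c) ≤ O.valuation (t - c')) → ∃ (A : Subalgebra k K) (h : A.toSubring ≤ O.toSubring), A₀ ≤ A ∧ t ∈ A ∧ A.FG ∧ IsFractionRing A K ∧ IsRegularLocalRing (Localization.AtPrime (Ideal.comap (Subring.inclusion h) (IsLocalRing.maximalIdeal O))) :=
  luAlphaPTorsor_dimTwo_of_not_immediate_of_curveMono stub_curveMonomialization

end Summit.ResolutionOfSingularities.ResolutionOfSingularities.Theorems.PfaffLine
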